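import Literature.AnabelianGeometry.EtaleTheta.LogDivisorModelGaloisAction
import Literature.AnabelianGeometry.EtaleTheta.LogDivisorModelToy
import Literature.AnabelianGeometry.EtaleTheta.DivisorMonoids

/-!
# [EtTh] Def. 3.3 (iii), step 2: the Def. 3.3 (iii) data `(Φ₀, B₀, B₀ → Φ₀^gp, F₀)` of the coverings
# dominated by ONE universal combinatorial covering, assembled as a `DivisorMonoids` record

S. Mochizuki, *The étale theta function …*, Publ. RIMS **45** (2009) [MochizukiEtTh2009], §3, Def. 3.3 (iii)
PRIMS PDF p.73 (printed p.299) [cite: MochizukiEtTh2009, Def 3.3 p.73]: "`Φ₀(Y^log) := lim Div⁺(Z^log_∞)^{Gal(Z^log_∞/Y^log)}`;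
`B₀(Y^log) := lim Mero(Z^log_∞)^{Gal(Z^log_∞/Y^log)}` … functors `Φ₀ : D₀ → 𝔐𝔬𝔫`; `B₀ : D₀ → 𝔐𝔬𝔫` …
together with a natural transformation `B₀ → Φ₀^gp` [given by assigning to a log-meromorphic function its
log-divisor of zeroes and poles], whose image we denote by `Φ₀^birat ⊆ Φ₀^gp`.  Also, we shall write
`F₀ ⊆ B₀` for the subfunctor determined by the constant log-meromorphic functions and `Φ₀^cnst ⊆ Φ₀^gp` for
the image of `F₀` in `Φ₀^gp`."

CLASS (b) CONSTRUCTION (abc-iut cell, L2 post-freeze rules (B)(3): a "…of<Data> producer"; the frozen files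
`TemperedCoverings.lean` (`LogDivisorModel`, Def. 3.1 / Prop. 3.2), `DivisorMonoids.lean` (`DivisorMonoids`,
Def. 3.3 (iii) OUTPUT data; `DivisorMonoids.Prop34`) and `LogDivisorModelToy.lean` are consumed BY NAME).
Input: a universal combinatorial covering `Z : LogDivisorModel`, its Galois group `G = Gal(Z^log_∞/X^log)`
acting through `A : Z.GaloisAction G` (`LogDivisorModelGaloisAction.lean`), and the two tacit Def. 3.1 (i)
compatibilities `hZ : Z.CuspLaws`.  Output:

* `GaloisAction.divZeroHom A S : B₀(S) →* Φ₀(S)^gp` — "assigning to a log-meromorphic function its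
  log-divisor of zeroes and poles": for `b ∈ Hom_G(S, Mero(Z^log_∞))` the element
  `[s ↦ div(b s) · div(b s)₋ⁿ] / [s ↦ div(b s)₋ⁿ]` of the Grothendieck group of
  `Φ₀(S) = Hom_G(S, Div⁺(Z^log_∞))`; WELL-DEFINED by Prop. 3.2 (i) (`LogDivisorModel.cartierNum_mem_Divplus`:
  a principal, hence Cartier, log-divisor is a quotient of EFFECTIVE CARTIER ones), characterised by
  `divZeroHom_eq_div_iff` ("`div₀ b = [N]/[D] ⟺ div(b s) · D s = N s` for all `s`") and natural in `S`;
* `GaloisAction.fZero A S ⊆ B₀(S)` — the constant log-meromorphic functions (`F₀`), `ncspZero` / `cspZero`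
  — the elements of `Φ₀(S)` with non-cuspidal / cuspidal values, and the PROVED unique decomposition
  "non-cuspidal × cuspidal" (`existsUnique_ncsp_csp`, from `hZ`);
* `DivisorMonoids.ofGaloisAction A hZ : DivisorMonoids (Action (Type u) G)` — the assembled Def. 3.3 (iii)
  record over the category of `G`-sets (coverings of `X^log` dominated by `Z^log_∞`; D₀'s connected ones
  are the transitive `G`-sets), every field a definition or a proof; and its non-vacuity
  `DivisorMonoids.nonempty_ofGaloisAction_toy` (trivial action on `LogDivisorModel.toy`).

This is the first `DivisorMonoids` inhabitant in the tree that is not a one-object toy: `Φ₀`, `B₀`, `div₀`,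
`F₀` are Def. 3.3 (iii)'s formulas at one term of the inductive limit (the limit itself — over the
`Δ^fil`-closures, Rmk. 3.3.1 "differ only by an extension of the base field" — is not formed:
TODO-merge(abc-iut-L3-t2)).  Prop. 3.4 (ii) for this data is PROVED from Prop. 3.2 (ii) in
`Discharge/Sec3Prop34iiOfGaloisCovering.lean`.  No named Prop fact, no instance, no sorry.  HONEST FRAMING:
a construction over typed interfaces; nothing here bears on [IUTchIII] Cor. 3.12; typed ≠ proved.
-/

namespace Literature.AnabelianGeometry.EtaleTheta

open CategoryTheory Opposite Literature.AlgebraicGeometry.Frobenioids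

namespace LogDivisorModel

universe u

/-- `LogDivisorModel.toy` (no cusps, no components, trivial divisors) satisfies the tacit cusp laws: the
predicate bundle `CuspLaws` is inhabited. [cite: MochizukiEtTh2009, Def 3.1 p.70] -/
theorem cuspLaws_toy : LogDivisorModel.toy.CuspLaws where
  cuspidal_le_Div := bot_le
  mem_cuspidal_iff _ := ⟨fun _ c => c.elim, fun _ => Subgroup.mem_bot.mpr rfl⟩

namespace GaloisAction

variable {Z : LogDivisorModel.{u}} {G : Type u} [Group G] (A : Z.GaloisAction G)
variable (S : Action (Type u) G)

/-! ## The natural transformation `B₀ → Φ₀^gp` ("log-divisor of zeroes and poles") -/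

/-- The divisor of `b s` for `b ∈ B₀(S)` (a Cartier log-divisor). [cite: MochizukiEtTh2009, Def 3.3 p.73] -/
def divAt (b : A.bZero S) (s : S.V) : Z.DIV := Z.divisor ⟨b.1 s, b.2.1 s⟩

/-- `divAt` is equivariant. [cite: MochizukiEtTh2009, Def 3.3 p.73] -/
theorem divAt_ρ (b : A.bZero S) (g : G) (s : S.V) : A.divAt S b (S.ρ g s) = A.actDIV g (A.divAt S b s) := by
  have e : (⟨b.1 (S.ρ g s), b.2.1 _⟩ : Z.logMero) = ⟨A.actFn g (b.1 s), A.act_mem_logMero g (b.2.1 s)⟩ :=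
    Subtype.ext (b.2.2 g s)
  rw [divAt, e, A.divisor_act' g (b.2.1 s)]
  rfl

/-- `divAt` is multiplicative in `b`. [cite: MochizukiEtTh2009, Def 3.3 p.73] -/
theorem divAt_mul (b c : A.bZero S) (s : S.V) : A.divAt S (b * c) s = A.divAt S b s * A.divAt S c s := by
  rw [divAt, divAt, divAt, ← map_mul]
  rfl

/-- `divAt 1 = 1`. [cite: MochizukiEtTh2009, Def 3.3 p.73] -/
theorem divAt_one (s : S.V) : A.divAt S 1 s = 1 := by
  rw [divAt]
  exact (congrArg Z.divisor (Subtype.ext rfl : (⟨(1 : A.bZero S).1 s, (1 : A.bZero S).2.1 s⟩ : Z.logMero) = 1)).trans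
    (map_one Z.divisor)

/-- `divAt` of a pull-back is the pull-back of `divAt`. [cite: MochizukiEtTh2009, Def 3.3 p.73] -/
theorem divAt_pull {S S' : Action (Type u) G} (f : S ⟶ S') (b : A.bZero S') (s : S.V) :
    A.divAt S (A.bZeroPull f b) s = A.divAt S' b (f.hom s) := rfl

/-- The NUMERATOR of `div₀ b`: `s ↦ div(b s) · div(b s)₋ⁿ`, an element of `Φ₀(S)` (effective Cartier values
by Prop. 3.2 (i), equivariant). [cite: MochizukiEtTh2009, Def 3.3 p.73] -/
noncomputable def divNum (b : A.bZero S) : A.phiZero S :=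
  ⟨fun s => Z.cartierNum (A.divAt S b s),
    fun s => Z.cartierNum_mem_Divplus (Z.divisor_mem_Div _),
    fun g s => by simp only [divAt_ρ, cartierNum_act]⟩

/-- The DENOMINATOR of `div₀ b`: `s ↦ div(b s)₋ⁿ`, an element of `Φ₀(S)`. [cite: MochizukiEtTh2009, Def 3.3 p.73] -/
noncomputable def divDen (b : A.bZero S) : A.phiZero S :=
  ⟨fun s => Z.cartierDen (A.divAt S b s),
    fun _ => Z.cartierDen_mem_Divplus _,
    fun g s => by simp only [divAt_ρ, cartierDen_act]⟩

/-- `div(b s) · (divDen b) s = (divNum b) s`. [cite: MochizukiEtTh2009, Def 3.3 p.73] -/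
theorem divAt_mul_divDen (b : A.bZero S) (s : S.V) :
    A.divAt S b s * (A.divDen S b).1 s = (A.divNum S b).1 s := rfl

/-- `[N]/[D] = [N']/[D']` in `Φ₀(S)^gp` iff `N · D' = N' · D` (`Φ₀(S)` is cancellative, being a submonoid of a
group). [cite: MochizukiEtTh2009, Def 3.3 p.73] -/
theorem of_div_of_eq_iff {N D N' D' : A.phiZero S} :
    Algebra.GrothendieckGroup.of N / Algebra.GrothendieckGroup.of D =
        Algebra.GrothendieckGroup.of N' / Algebra.GrothendieckGroup.of D' ↔ N * D' = N' * D := by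
  rw [div_eq_div_iff_mul_eq_mul, ← map_mul, ← map_mul, Algebra.GrothendieckGroup.of_injective.eq_iff]

/-- **`div₀ : B₀(S) → Φ₀(S)^gp`**, "assigning to a log-meromorphic function its log-divisor of zeroes and
poles" (Def. 3.3 (iii)): `b ↦ [divNum b] / [divDen b]`. [cite: MochizukiEtTh2009, Def 3.3 p.73] -/
noncomputable def divZero (b : A.bZero S) : Algebra.GrothendieckGroup (A.phiZero S) :=
  Algebra.GrothendieckGroup.of (A.divNum S b) / Algebra.GrothendieckGroup.of (A.divDen S b)

/-- **Characterisation of `div₀`**: `div₀ b = [N]/[D]` iff `div(b s) · D s = N s` for every `s` — i.e.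
`div₀ b` IS the divisor of `b`, read in `Φ₀(S)^gp ⊆ Hom_G(S, DIV(Z^log_∞))`. [cite: MochizukiEtTh2009, Def 3.3 p.73] -/
theorem divZero_eq_div_iff (b : A.bZero S) (N D : A.phiZero S) :
    A.divZero S b = Algebra.GrothendieckGroup.of N / Algebra.GrothendieckGroup.of D ↔
      ∀ s, A.divAt S b s * D.1 s = N.1 s := by
  rw [divZero, of_div_of_eq_iff]
  constructor
  · intro h s
    have hs := congrArg (fun φ : A.phiZero S => φ.1 s) h
    simp only [Submonoid.coe_mul, Pi.mul_apply] at hs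
    rw [← divAt_mul_divDen] at hs
    -- `div · Den · D = N · Den`; cancel `Den`
    have : A.divAt S b s * D.1 s * (A.divDen S b).1 s = N.1 s * (A.divDen S b).1 s := by
      rw [← hs]; simp only [mul_assoc, mul_comm, mul_left_comm]
    exact mul_right_cancel this
  · intro h
    refine Subtype.ext (funext fun s => ?_)
    simp only [Submonoid.coe_mul, Pi.mul_apply]
    rw [← divAt_mul_divDen, ← h s]
    simp only [mul_assoc, mul_comm, mul_left_comm]

/-- **`div₀` as a monoid homomorphism `B₀(S) →* Φ₀(S)^gp`** (the component at `S` of the natural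
transformation `B₀ → Φ₀^gp`). [cite: MochizukiEtTh2009, Def 3.3 p.73] -/
noncomputable def divZeroHom : A.bZero S →* Algebra.GrothendieckGroup (A.phiZero S) where
  toFun := A.divZero S
  map_one' := by
    have h : A.divZero S 1 = Algebra.GrothendieckGroup.of 1 / Algebra.GrothendieckGroup.of 1 :=
      (A.divZero_eq_div_iff S 1 1 1).2 fun s => by rw [divAt_one, one_mul]
    rw [h, div_self']
  map_mul' b c := by
    have h : A.divZero S (b * c) = Algebra.GrothendieckGroup.of (A.divNum S b * A.divNum S c) /
        Algebra.GrothendieckGroup.of (A.divDen S b * A.divDen S c) :=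
      (A.divZero_eq_div_iff S (b * c) _ _).2 fun s => by
        rw [Submonoid.coe_mul, Submonoid.coe_mul, Pi.mul_apply, Pi.mul_apply, divAt_mul,
          ← divAt_mul_divDen, ← divAt_mul_divDen]
        exact mul_mul_mul_comm _ _ _ _
    rw [h, map_mul, map_mul, ← div_mul_div_comm]
    rfl

/-- `divZeroHom` is `divZero`. [cite: MochizukiEtTh2009, Def 3.3 p.73] -/
@[simp] theorem divZeroHom_apply (b : A.bZero S) : A.divZeroHom S b = A.divZero S b := rfl

/-- Characterisation of `divZeroHom` (see `divZero_eq_div_iff`). [cite: MochizukiEtTh2009, Def 3.3 p.73] -/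
theorem divZeroHom_eq_div_iff (b : A.bZero S) (N D : A.phiZero S) :
    A.divZeroHom S b = Algebra.GrothendieckGroup.of N / Algebra.GrothendieckGroup.of D ↔
      ∀ s, A.divAt S b s * D.1 s = N.1 s :=
  A.divZero_eq_div_iff S b N D

variable {S} in
/-- **Naturality of `B₀ → Φ₀^gp`**: the divisor of a pulled-back function is the pulled-back divisor.
[cite: MochizukiEtTh2009, Def 3.3 p.73] -/
theorem divZero_pull {S S' : Action (Type u) G} (f : S ⟶ S') (b : A.bZero S') :
    A.divZero S (A.bZeroPull f b) = gpMap (A.phiZeroPull f) (A.divZero S' b) := by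
  rw [divZero, divZero, map_div, gpMap_of, gpMap_of]
  rfl

/-! ## `F₀ ⊆ B₀` and the (non-)cuspidal submonoids of `Φ₀` -/

/-- **`F₀(S) ⊆ B₀(S)`**: "the subfunctor determined by the constant log-meromorphic functions" — the
equivariant maps with values in the constants `L^×`. [cite: MochizukiEtTh2009, Def 3.3 p.73] -/
def fZero : Submonoid (A.bZero S) where
  carrier := {b | ∀ s, b.1 s ∈ Z.const}
  mul_mem' h h' s := Z.const.mul_mem (h s) (h' s)
  one_mem' _ := Z.const.one_mem

/-- Membership in `F₀(S)`. [cite: MochizukiEtTh2009, Def 3.3 p.73] -/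
theorem mem_fZero_iff (b : A.bZero S) : b ∈ A.fZero S ↔ ∀ s, b.1 s ∈ Z.const := Iff.rfl

/-- Elements of `Φ₀(S)` "arising from non-cuspidal log-divisors" (values supported in the special fibre).
[cite: MochizukiEtTh2009, Def 3.3 p.73] -/
def ncspZero : Submonoid (A.phiZero S) where
  carrier := {φ | ∀ s, φ.1 s ∈ Z.nonCuspidal}
  mul_mem' h h' s := Z.nonCuspidal.mul_mem (h s) (h' s)
  one_mem' _ := Z.nonCuspidal.one_mem

/-- Elements of `Φ₀(S)` "arising from cuspidal log-divisors" (values supported in the divisor of cusps).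
[cite: MochizukiEtTh2009, Def 3.3 p.73] -/
def cspZero : Submonoid (A.phiZero S) where
  carrier := {φ | ∀ s, φ.1 s ∈ Z.cuspidal}
  mul_mem' h h' s := Z.cuspidal.mul_mem (h s) (h' s)
  one_mem' _ := Z.cuspidal.one_mem

/-- Membership in `ncspZero`. [cite: MochizukiEtTh2009, Def 3.3 p.73] -/
theorem mem_ncspZero_iff (φ : A.phiZero S) : φ ∈ A.ncspZero S ↔ ∀ s, φ.1 s ∈ Z.nonCuspidal := Iff.rfl

/-- Membership in `cspZero`. [cite: MochizukiEtTh2009, Def 3.3 p.73] -/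
theorem mem_cspZero_iff (φ : A.phiZero S) : φ ∈ A.cspZero S ↔ ∀ s, φ.1 s ∈ Z.cuspidal := Iff.rfl

/-- The cuspidal part of `φ ∈ Φ₀(S)`, pointwise (Cartier by `CuspLaws.cuspidal_le_Div`).
[cite: MochizukiEtTh2009, Def 3.3 p.73] -/
def cspPartOf (hZ : Z.CuspLaws) (φ : A.phiZero S) : A.cspZero S :=
  ⟨⟨fun s => (Z.cuspPart ⟨φ.1 s, (φ.2.1 s).2⟩ : Z.DIV),
    fun s => ⟨hZ.cuspidal_le_Div ((hZ.mem_cuspidal_iff _).2 fun c => by simp [cuspPart]),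
      (Z.cuspPart _).2⟩,
    fun g s => by
      have e : (⟨φ.1 (S.ρ g s), (φ.2.1 _).2⟩ : Z.DIVplus) = A.actDIVplus g ⟨φ.1 s, (φ.2.1 s).2⟩ :=
        Subtype.ext (φ.2.2 g s)
      dsimp only
      rw [e, cuspPart_act, coe_actDIVplus]⟩,
    fun s => (hZ.mem_cuspidal_iff _).2 fun c => by simp [cuspPart]⟩

/-- Values of the cuspidal part. [cite: MochizukiEtTh2009, Def 3.3 p.73] -/
theorem cspPartOf_apply (hZ : Z.CuspLaws) (φ : A.phiZero S) (s : S.V) :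
    (A.cspPartOf S hZ φ).1.1 s = (Z.cuspPart ⟨φ.1 s, (φ.2.1 s).2⟩ : Z.DIV) := rfl

/-- The cuspidal part of an effective Cartier log-divisor is Cartier (tacit cusp law (1)).
[cite: MochizukiEtTh2009, Def 3.1 p.70] -/
theorem cuspPart_mem_Div (hZ : Z.CuspLaws) (d : Z.DIVplus) : (Z.cuspPart d : Z.DIV) ∈ Z.Div :=
  hZ.cuspidal_le_Div ((hZ.mem_cuspidal_iff _).2 fun c => by simp [cuspPart])

/-- The non-cuspidal part of an effective CARTIER log-divisor is Cartier (quotient by the cuspidal part).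
[cite: MochizukiEtTh2009, Def 3.1 p.70] -/
theorem compPart_mem_Div (hZ : Z.CuspLaws) {d : Z.DIVplus} (hd : (d : Z.DIV) ∈ Z.Div) :
    (Z.compPart d : Z.DIV) ∈ Z.Div := by
  have h : (Z.compPart d : Z.DIV) = (d : Z.DIV) / (Z.cuspPart d : Z.DIV) := by
    rw [eq_div_iff_mul_eq', ← Submonoid.coe_mul, compPart_mul_cuspPart]
  rw [h]
  exact Z.Div.div_mem hd (cuspPart_mem_Div hZ d)

/-- The non-cuspidal part of `φ ∈ Φ₀(S)`, pointwise. [cite: MochizukiEtTh2009, Def 3.3 p.73] -/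
def ncspPartOf (hZ : Z.CuspLaws) (φ : A.phiZero S) : A.ncspZero S :=
  ⟨⟨fun s => (Z.compPart ⟨φ.1 s, (φ.2.1 s).2⟩ : Z.DIV),
    fun s => ⟨compPart_mem_Div hZ (φ.2.1 s).1, (Z.compPart _).2⟩,
    fun g s => by
      have e : (⟨φ.1 (S.ρ g s), (φ.2.1 _).2⟩ : Z.DIVplus) = A.actDIVplus g ⟨φ.1 s, (φ.2.1 s).2⟩ :=
        Subtype.ext (φ.2.2 g s)
      dsimp only
      rw [e, compPart_act, coe_actDIVplus]⟩,
    fun s => Z.compPart_mem_nonCuspidal _⟩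

/-- Values of the non-cuspidal part. [cite: MochizukiEtTh2009, Def 3.3 p.73] -/
theorem ncspPartOf_apply (hZ : Z.CuspLaws) (φ : A.phiZero S) (s : S.V) :
    (A.ncspPartOf S hZ φ).1.1 s = (Z.compPart ⟨φ.1 s, (φ.2.1 s).2⟩ : Z.DIV) := rfl

/-- `φ = (non-cuspidal part) · (cuspidal part)` in `Φ₀(S)`. [cite: MochizukiEtTh2009, Def 3.3 p.73] -/
theorem ncspPartOf_mul_cspPartOf (hZ : Z.CuspLaws) (φ : A.phiZero S) :
    (A.ncspPartOf S hZ φ : A.phiZero S) * (A.cspPartOf S hZ φ : A.phiZero S) = φ := by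
  refine Subtype.ext (funext fun s => ?_)
  rw [Submonoid.coe_mul, Pi.mul_apply, ncspPartOf_apply, cspPartOf_apply, ← Submonoid.coe_mul,
    compPart_mul_cuspPart]

/-- **Def. 3.3 (iii) / Def. 3.1 (i): every element of `Φ₀(S)` is uniquely a non-cuspidal times a cuspidal one**
("log-divisors are supported in the union of the special fiber and divisor of cusps"), PROVED from the
coordinates of Def. 3.1 (i) and the tacit cusp laws. [cite: MochizukiEtTh2009, Def 3.3 p.73] -/
theorem existsUnique_ncsp_csp (hZ : Z.CuspLaws) (φ : A.phiZero S) :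
    ∃! p : A.ncspZero S × A.cspZero S, (p.1 : A.phiZero S) * p.2 = φ := by
  refine ⟨(A.ncspPartOf S hZ φ, A.cspPartOf S hZ φ), A.ncspPartOf_mul_cspPartOf S hZ φ, ?_⟩
  rintro ⟨ν, κ⟩ h
  have hdisj : ∀ {x : Z.DIV}, x ∈ Z.nonCuspidal → x ∈ Z.cuspidal → x = 1 :=
    Subgroup.disjoint_def.mp Z.nonCuspidal_isCompl_cuspidal.disjoint
  have hpt : ∀ s, ν.1.1 s * κ.1.1 s = (A.ncspPartOf S hZ φ).1.1 s * (A.cspPartOf S hZ φ).1.1 s :=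
    fun s => by
      have h1 := congrArg (fun ψ : A.phiZero S => ψ.1 s) h
      have h2 := congrArg (fun ψ : A.phiZero S => ψ.1 s) (A.ncspPartOf_mul_cspPartOf S hZ φ)
      simp only [Submonoid.coe_mul, Pi.mul_apply] at h1 h2
      rw [h1, h2]
  have hν : ∀ s, ν.1.1 s = (A.ncspPartOf S hZ φ).1.1 s := fun s => by
    -- `ν s / ν' s = κ' s / κ s` lies in `nonCuspidal ⊓ cuspidal = ⊥`
    have hq : ν.1.1 s / (A.ncspPartOf S hZ φ).1.1 s = (A.cspPartOf S hZ φ).1.1 s / κ.1.1 s := by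
      rw [div_eq_div_iff_mul_eq_mul, hpt s, mul_comm]
    have hmem : ν.1.1 s / (A.ncspPartOf S hZ φ).1.1 s ∈ Z.cuspidal := by
      rw [hq]
      exact Z.cuspidal.div_mem ((A.cspPartOf S hZ φ).2 s) (κ.2 s)
    exact div_eq_one.mp (hdisj (Z.nonCuspidal.div_mem (ν.2 s) ((A.ncspPartOf S hZ φ).2 s)) hmem)
  have hκ : ∀ s, κ.1.1 s = (A.cspPartOf S hZ φ).1.1 s := fun s => by
    have := hpt s
    rw [hν s] at this
    exact mul_left_cancel this
  exact Prod.ext (Subtype.ext (Subtype.ext (funext hν))) (Subtype.ext (Subtype.ext (funext hκ)))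

end GaloisAction

end LogDivisorModel

/-! ## The assembled Def. 3.3 (iii) record -/

namespace DivisorMonoids

universe u

variable {Z : LogDivisorModel.{u}} {G : Type u} [Group G]

/-- **Def. 3.3 (iii) data of the coverings dominated by one universal combinatorial covering** — the
`DivisorMonoids` record over the `G`-sets, `G = Gal(Z^log_∞/X^log)`: `Φ₀(S) = Hom_G(S, Div⁺(Z^log_∞))`,
`B₀(S) = Hom_G(S, Mero(Z^log_∞))` (a group), `div₀` = "log-divisor of zeroes and poles" (natural in `S`),
`F₀(S)` = the constant ones, `ncsp₀`/`csp₀` = non-cuspidal/cuspidal values with the PROVED unique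
decomposition.  Every field is a definition or a theorem; inputs = the Galois-action record `A` and the
tacit cusp laws `hZ`. [cite: MochizukiEtTh2009, Def 3.3 p.73] -/
noncomputable def ofGaloisAction (A : Z.GaloisAction G) (hZ : Z.CuspLaws) :
    DivisorMonoids.{u + 1, u, u} (Action (Type u) G) where
  Φ₀ := A.PhiZero
  B₀ := A.BZero
  isUnit_B₀ S b := by
    change IsUnit (M := A.bZero S.unop) b
    exact Group.isUnit _
  div₀ S := A.divZeroHom S.unop
  div₀_natural f b := A.divZero_pull f.unop b
  F₀ S := A.fZero S.unop
  F₀_map f b hb s := hb _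
  ncsp₀ S := A.ncspZero S.unop
  csp₀ S := A.cspZero S.unop
  ncsp₀_map f x hx s := hx _
  csp₀_map f x hx s := hx _
  existsUnique_ncsp_csp S x := A.existsUnique_ncsp_csp S.unop hZ x

/-- `Φ₀` of the assembled record is `Hom_G(−, Div⁺(Z^log_∞))`. [cite: MochizukiEtTh2009, Def 3.3 p.73] -/
theorem ofGaloisAction_Φ₀ (A : Z.GaloisAction G) (hZ : Z.CuspLaws) : (ofGaloisAction A hZ).Φ₀ = A.PhiZero := rfl

/-- `B₀` of the assembled record is `Hom_G(−, Mero(Z^log_∞))`. [cite: MochizukiEtTh2009, Def 3.3 p.73] -/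
theorem ofGaloisAction_B₀ (A : Z.GaloisAction G) (hZ : Z.CuspLaws) : (ofGaloisAction A hZ).B₀ = A.BZero := rfl

/-- `div₀` of the assembled record is `divZeroHom`. [cite: MochizukiEtTh2009, Def 3.3 p.73] -/
theorem ofGaloisAction_div₀ (A : Z.GaloisAction G) (hZ : Z.CuspLaws) (S : (Action (Type u) G)ᵒᵖ) :
    (ofGaloisAction A hZ).div₀ S = A.divZeroHom S.unop := rfl

/-- `F₀` of the assembled record is `fZero`. [cite: MochizukiEtTh2009, Def 3.3 p.73] -/
theorem ofGaloisAction_F₀ (A : Z.GaloisAction G) (hZ : Z.CuspLaws) (S : (Action (Type u) G)ᵒᵖ) :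
    (ofGaloisAction A hZ).F₀ S = A.fZero S.unop := rfl

/-- **Non-vacuity**: the construction applies to the trivial action of any group on `LogDivisorModel.toy` —
the input stack `(LogDivisorModel, GaloisAction, CuspLaws)` is jointly inhabited and `ofGaloisAction`
produces a `DivisorMonoids` record over the `G`-sets. [cite: MochizukiEtTh2009, Def 3.3 p.73] -/
theorem nonempty_ofGaloisAction_toy (G : Type) [Group G] :
    Nonempty (DivisorMonoids.{1, 0, 0} (Action (Type 0) G)) :=
  ⟨ofGaloisAction (LogDivisorModel.GaloisAction.trivial LogDivisorModel.toy G) LogDivisorModel.cuspLaws_toy⟩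

end DivisorMonoids

end Literature.AnabelianGeometry.EtaleTheta
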